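import Summits.ResolutionOfSingularities.ResolutionOfSingularities.Theorems.EquisingularLiftEquisingularLiftNatSmoothConeBlowup
import Summits.ResolutionOfSingularities.ResolutionOfSingularities.Theorems.EquisingularLiftEquisingularLiftNatDoubledConeSaturation
import HarnessLib

/-!
# [OURS · L1 W4.5(b) · EL♮(3)] T-M1-EXACT, ring core: an EQUIMULTIPLE lift has strict transform with EXACT special fibre
# — reduction modulo the uniformizer commutes with the strict transform on every chart of the blow-up along the section

Support file of the crux chain w45b (cell `res-hironaka`, LADDER-RESOLUTION rung L, slot W4.5(b)), working crux
**EL♮ = `Theses.EquisingularLift.EquisingularLiftNat`** (stmt-ResolutionOfSingularities-20038) and its `n = 3` child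
`EquisingularLiftNatThree` (stmt-ResolutionOfSingularities-20148), registered stubs `stub_elnat_tcDeltaPointResolution` /
`stub_elnat_three_isolated_nontc` (skeleton v5.1, res-L1-w45b-lead-2). OURS; NOT a statement of any manuscript; AI-written, weaker
than expert review. Filed `--supports stmt-ResolutionOfSingularities-20148 --as helper` by res-L1-w45b-stub-3 (self-dealt object
T-M1-EXACT, STATUS 2026-08-27T08:33Z), the ring half of res-L1-w45b-lead-2 DESIGN v6 (TC⁺) «`V(G̃) ⊂ E_O` equimultiple
(mult `m_q`) along the in-carrier section `s_q` ⇒ `St_{s_q} V(G̃) = Bl_{s_q} V(G̃)` has special fibre EXACTLY `St_q(Z)`» =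
res-L1-w45b-plan-1 PLANNER-MEMO g7-1 v2 M1 (PROXIMITY LIFT); it is the chart-level form of the model-square hypothesis
`C.comap j = D` of res-D-pv-029's `modelStep` (…NatModelStep) for such centres.

SETTING (any commutative ring `A`; notation of `…NatSmoothConeBlowupChart` = part 1 and `…NatSmoothConeBlowup` = part 2).
`x = (x₁, …, x_r)` in `A`, `I = (x)` (the ideal of the SECTION; `A/I ≅ O` a domain), `ϖ ∈ A` (the uniformizer, `ϖ ∉ I`),
`B = A[I/xᵢ]`, `t = xᵢ/1`; DOWNSTAIRS `Ā = A/ϖ`, `x̄ = x mod ϖ`, `Ī = (x̄)` (the ideal of the POINT `q`; `Ā/Ī ≅ k`),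
`B̄ = Ā[Ī/x̄ᵢ]`, `t̄`; the reduction map `θ : B → B̄` (`blowupAlgebraMap` along `A → Ā`, Görtz–Wedhorn 13.96 (2); surjective with
kernel `ϖB` — res-L1-w45b-stub-1's `ker_blowupAlgebraMap_quotient_uniformizer`, p510548). The hypersurface: `G = Φ(x) + Ψ`,
`Φ` a form of degree `m` over `A`, `Ψ ∈ I^{m+1}` (so `G ∈ I^m`: «`V(G)` has order `≥ m` along the section»); strict transform
`g₁ = Φ(e) + tψ` (part 1); downstairs `Ḡ = Φ̄(x̄) + Ψ̄`, `ḡ₁ = θ(g₁) = Φ̄(ē) + t̄ θ(ψ)`.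

EQUIMULTIPLICITY along the section on the chart `i` := «`Φ̄ᵢ mod Ī ≠ 0`», i.e. the reduction `ḡ = G mod ϖ` still has order
EXACTLY `m` at the point `q` on the chart (`ord_Ī ḡ = m = ord_I G`); it implies `Φᵢ mod I ≠ 0` upstairs.

* `blowupAlgebraMap_coneTransform`, `blowupAlgebraMap_strictTransform` — `θ(Φ(e)) = Φ̄(ē)`, `θ(g₁) = ḡ₁`: the cone / strict
  transform generators reduce to the downstairs ones;
* `map_blowupAlgebraMap_span_strictTransform` — `θ((g₁)) = (ḡ₁)`;
* **`map_blowupAlgebraMap_strictTransformIdeal_eq`** — EXACTNESS: under equimultiplicity (`x`, `x̄` quasi-regular, `A/I` and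
  `Ā/Ī` domains), **the image under `θ` of the upstairs strict-transform ideal `⋃ₙ ((G) : tⁿ)` IS the downstairs strict-transform
  ideal `⋃ₙ ((Ḡ) : t̄ⁿ)`** — the special fibre of `St_s V(G)` is EXACTLY `St_q V(ḡ)` on the chart, with NO exceptional component;
* `ker_mk_comp_blowupAlgebraMap_eq`, **`exists_quotient_sup_uniformizer_equiv`** — `ϖ ∉ I` ⇒ (for any `g`, in
  particular `g₁`) **`B/(g₁, ϖ) ≅ B̄/(ḡ₁)`** (`θ` surjective, `ker θ = ϖB`): the reduction modulo `ϖ` of the strict-transform chart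
  `B/(g₁) ≅ (A/(G))[Ī/x̄ᵢ]` (part 1) is the downstairs strict-transform chart `B̄/(ḡ₁) ≅ (Ā/(Ḡ))[…]` (part 1 downstairs) —
  the MODEL SQUARE on the chart;
* `notMem_sq_of_blowupAlgebraMap_notMem_sq` — ORDER ONE transfers UP: if `ḡ₁ ∉ 𝔪̄²` at a prime `𝔐̄` of `B̄` then
  `g₁ ∉ 𝔪²` at `𝔐 = θ⁻¹𝔐̄` (the local map `B_𝔐 → B̄_𝔐̄` is local);
* **`isRegularLocalRing_quotient_of_reduction_notMem_sq`** — hence, for `A`, `A/I` regular and `x` quasi-regular, the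
  strict transform `B_𝔐/(g₁)` (any model `S`) is a REGULAR local ring at every special point where the downstairs strict transform
  has order one (`ḡ₁ ∉ 𝔪̄²`, e.g. where `St_q V(ḡ)` is a regular curve in the regular surface chart): the proximity-lift centre
  is regular wherever `St_q(Z)` is, `H`-independently;
* `iSup_colon_span_tangentCone_eq_span_strictTransform_localization` — part 1's saturation statement in every localisation of
  the chart (stalk currency for res-type-100 / res-type-097).

Not covered, and said so: the finitely many special points where `St_q(Z)` is singular (there the upstairs centre needs the
Δ-criterion / res-type-032's genericity, or part 2's derivative test), `O`-flatness, and the scheme-level assembly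
(`C.comap j = D` for ideal SHEAVES — res-D-pv-029 / res-type-100 dictionaries).

References: Hironaka–(Ito–)Oda style «normal flatness ⇒ blowing up commutes with specialisation» is the geometry behind it; here
only: The Stacks Project, Tags 052Q, 0BIQ, 080C; Görtz–Wedhorn, *Algebraic Geometry I* (2020), (13.19), Prop. 13.96 (2);
Matsumura, *Commutative Ring Theory*, Thm. 14.2. Tree inputs: parts 1–2 (p511641, p512906), `…NatDoubledConeSaturation`
(p510548, res-L1-w45b-stub-1), `…NatConeChart` (p508912, res-type-100), `BlowupStrictTransform` (`blowupAlgebraMap`).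
-/

set_option linter.dupNamespace false -- mandated namespace `Summit.<Summit>.<Problem>` of this single-conjunct summit

noncomputable section

namespace Summit.ResolutionOfSingularities.ResolutionOfSingularities.Cruxes.EquisingularLiftNat.Sections

open MvPolynomial IsLocalization IsLocalRing Literature.AlgebraicGeometry.Resolution

universe u

section Reduction

variable {A : Type u} [CommRing A] {r : ℕ} (x : Fin r → A) (i : Fin r) (ϖ : A)

/-- `I·Ā = Ī`: the image of `I = (x)` in `A/ϖ` is generated by the reductions `x̄`. [folklore] -/
theorem map_span_range_eq_span_range_mk :
    (Ideal.span (Set.range x)).map (Ideal.Quotient.mk (Ideal.span {ϖ})) =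
      Ideal.span (Set.range fun l => Ideal.Quotient.mk (Ideal.span {ϖ}) (x l)) := by
  rw [Ideal.map_span, ← Set.range_comp]
  rfl

/-- `I·Ā ≤ Ī` (the hypothesis of `blowupAlgebraMap`). [folklore] -/
theorem map_span_range_le_span_range_mk :
    (Ideal.span (Set.range x)).map (Ideal.Quotient.mk (Ideal.span {ϖ})) ≤
      Ideal.span (Set.range fun l => Ideal.Quotient.mk (Ideal.span {ϖ}) (x l)) :=
  (map_span_range_eq_span_range_mk x ϖ).le

/-- **The reduction map `θ : A[I/xᵢ] → Ā[Ī/x̄ᵢ]` on cone transforms: `θ(Φ(e)) = Φ̄(ē)`** (`Φ̄ = Φ mod ϖ`; `θ(a/1) = ā/1`,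
`θ(x_j/xᵢ) = x̄_j/x̄ᵢ`). [cite: GortzWedhorn2020, Prop. 13.96 (2) (proof), p. 416] -/
theorem blowupAlgebraMap_coneTransform (Φ : MvPolynomial (Fin r) A) :
    blowupAlgebraMap (Ideal.Quotient.mk (Ideal.span {ϖ})) (Ideal.span (Set.range x))
        (Ideal.span (Set.range fun l => Ideal.Quotient.mk (Ideal.span {ϖ}) (x l))) (x i)
        (map_span_range_le_span_range_mk x ϖ) (MvPolynomial.aeval (blowupAlgebra.frac x i) Φ) =
      MvPolynomial.aeval (blowupAlgebra.frac (fun l => Ideal.Quotient.mk (Ideal.span {ϖ}) (x l)) i)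
        (MvPolynomial.map (Ideal.Quotient.mk (Ideal.span {ϖ})) Φ) := by
  set θ := blowupAlgebraMap (Ideal.Quotient.mk (Ideal.span {ϖ})) (Ideal.span (Set.range x))
    (Ideal.span (Set.range fun l => Ideal.Quotient.mk (Ideal.span {ϖ}) (x l))) (x i)
    (map_span_range_le_span_range_mk x ϖ) with hθ
  induction Φ using MvPolynomial.induction_on with
  | C a =>
    rw [MvPolynomial.map_C, MvPolynomial.algHom_C, MvPolynomial.algHom_C, hθ, blowupAlgebraMap_algebraMap]
  | add p q hp hq => simp only [map_add, hp, hq]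
  | mul_X p j hp =>
    simp only [map_mul, hp, MvPolynomial.map_X, MvPolynomial.aeval_X]
    congr 1
    exact blowupAlgebraMap_gen _ _ _ _ _ (x j) (blowupAlgebra.mem_span_range x j)

/-- **`θ(g₁) = ḡ₁`**: the strict-transform generator `g₁ = Φ(e) + tψ` reduces to `Φ̄(ē) + t̄·θ(ψ)`. [folklore] -/
theorem blowupAlgebraMap_strictTransform (Φ : MvPolynomial (Fin r) A)
    (ψ : blowupAlgebra (Ideal.span (Set.range x)) (x i)) :
    blowupAlgebraMap (Ideal.Quotient.mk (Ideal.span {ϖ})) (Ideal.span (Set.range x))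
        (Ideal.span (Set.range fun l => Ideal.Quotient.mk (Ideal.span {ϖ}) (x l))) (x i)
        (map_span_range_le_span_range_mk x ϖ)
        (MvPolynomial.aeval (blowupAlgebra.frac x i) Φ +
          algebraMap A (blowupAlgebra (Ideal.span (Set.range x)) (x i)) (x i) * ψ) =
      MvPolynomial.aeval (blowupAlgebra.frac (fun l => Ideal.Quotient.mk (Ideal.span {ϖ}) (x l)) i)
          (MvPolynomial.map (Ideal.Quotient.mk (Ideal.span {ϖ})) Φ) +
        algebraMap (A ⧸ Ideal.span {ϖ}) (blowupAlgebra (Ideal.span (Set.range fun l => Ideal.Quotient.mk (Ideal.span {ϖ}) (x l)))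
            (Ideal.Quotient.mk (Ideal.span {ϖ}) (x i))) (Ideal.Quotient.mk (Ideal.span {ϖ}) (x i)) *
          blowupAlgebraMap (Ideal.Quotient.mk (Ideal.span {ϖ})) (Ideal.span (Set.range x))
            (Ideal.span (Set.range fun l => Ideal.Quotient.mk (Ideal.span {ϖ}) (x l))) (x i)
            (map_span_range_le_span_range_mk x ϖ) ψ := by
  rw [map_add, map_mul, blowupAlgebraMap_coneTransform, blowupAlgebraMap_algebraMap]

/-- `θ((g₁)) = (ḡ₁)` as ideals. [folklore] -/
theorem map_blowupAlgebraMap_span_strictTransform (Φ : MvPolynomial (Fin r) A)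
    (ψ : blowupAlgebra (Ideal.span (Set.range x)) (x i)) :
    (Ideal.span {MvPolynomial.aeval (blowupAlgebra.frac x i) Φ +
          algebraMap A (blowupAlgebra (Ideal.span (Set.range x)) (x i)) (x i) * ψ}).map
        (blowupAlgebraMap (Ideal.Quotient.mk (Ideal.span {ϖ})) (Ideal.span (Set.range x))
          (Ideal.span (Set.range fun l => Ideal.Quotient.mk (Ideal.span {ϖ}) (x l))) (x i)
          (map_span_range_le_span_range_mk x ϖ)) =
      Ideal.span {MvPolynomial.aeval (blowupAlgebra.frac (fun l => Ideal.Quotient.mk (Ideal.span {ϖ}) (x l)) i)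
          (MvPolynomial.map (Ideal.Quotient.mk (Ideal.span {ϖ})) Φ) +
        algebraMap (A ⧸ Ideal.span {ϖ}) (blowupAlgebra (Ideal.span (Set.range fun l => Ideal.Quotient.mk (Ideal.span {ϖ}) (x l)))
            (Ideal.Quotient.mk (Ideal.span {ϖ}) (x i))) (Ideal.Quotient.mk (Ideal.span {ϖ}) (x i)) *
          blowupAlgebraMap (Ideal.Quotient.mk (Ideal.span {ϖ})) (Ideal.span (Set.range x))
            (Ideal.span (Set.range fun l => Ideal.Quotient.mk (Ideal.span {ϖ}) (x l))) (x i)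
            (map_span_range_le_span_range_mk x ϖ) ψ} := by
  rw [Ideal.map_span, Set.image_singleton, blowupAlgebraMap_strictTransform]

/-- The total transform reduces too: from `G = tᵈ g₁` upstairs, `Ḡ = t̄ᵈ ḡ₁` downstairs. [folklore] -/
theorem algebraMap_mk_tangentCone_eq {d : ℕ} (Φ : MvPolynomial (Fin r) A)
    (ψ : blowupAlgebra (Ideal.span (Set.range x)) (x i)) {G : A}
    (hG : algebraMap A (blowupAlgebra (Ideal.span (Set.range x)) (x i)) G =
      algebraMap A (blowupAlgebra (Ideal.span (Set.range x)) (x i)) (x i) ^ d *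
        (MvPolynomial.aeval (blowupAlgebra.frac x i) Φ +
          algebraMap A (blowupAlgebra (Ideal.span (Set.range x)) (x i)) (x i) * ψ)) :
    algebraMap (A ⧸ Ideal.span {ϖ})
        (blowupAlgebra (Ideal.span (Set.range fun l => Ideal.Quotient.mk (Ideal.span {ϖ}) (x l)))
          (Ideal.Quotient.mk (Ideal.span {ϖ}) (x i))) (Ideal.Quotient.mk (Ideal.span {ϖ}) G) =
      algebraMap (A ⧸ Ideal.span {ϖ})
          (blowupAlgebra (Ideal.span (Set.range fun l => Ideal.Quotient.mk (Ideal.span {ϖ}) (x l)))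
            (Ideal.Quotient.mk (Ideal.span {ϖ}) (x i))) (Ideal.Quotient.mk (Ideal.span {ϖ}) (x i)) ^ d *
        (MvPolynomial.aeval (blowupAlgebra.frac (fun l => Ideal.Quotient.mk (Ideal.span {ϖ}) (x l)) i)
            (MvPolynomial.map (Ideal.Quotient.mk (Ideal.span {ϖ})) Φ) +
          algebraMap (A ⧸ Ideal.span {ϖ})
              (blowupAlgebra (Ideal.span (Set.range fun l => Ideal.Quotient.mk (Ideal.span {ϖ}) (x l)))
                (Ideal.Quotient.mk (Ideal.span {ϖ}) (x i))) (Ideal.Quotient.mk (Ideal.span {ϖ}) (x i)) *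
            blowupAlgebraMap (Ideal.Quotient.mk (Ideal.span {ϖ})) (Ideal.span (Set.range x))
              (Ideal.span (Set.range fun l => Ideal.Quotient.mk (Ideal.span {ϖ}) (x l))) (x i)
              (map_span_range_le_span_range_mk x ϖ) ψ) := by
  have h := congrArg (blowupAlgebraMap (Ideal.Quotient.mk (Ideal.span {ϖ})) (Ideal.span (Set.range x))
    (Ideal.span (Set.range fun l => Ideal.Quotient.mk (Ideal.span {ϖ}) (x l))) (x i)
    (map_span_range_le_span_range_mk x ϖ)) hG
  rw [blowupAlgebraMap_algebraMap, map_mul, map_pow, blowupAlgebraMap_algebraMap, blowupAlgebraMap_strictTransform] at h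
  exact h

/-! ## Exactness of the special fibre of the strict transform -/

/-- **T-M1-EXACT.** Let `x` be quasi-regular with `A/I` a domain and `Φᵢ mod I ≠ 0`, and let the reductions `x̄ = x mod ϖ` be
quasi-regular with `Ā/Ī` a domain (`Ā = A/ϖ`) and `Φ̄ᵢ mod Ī ≠ 0` — EQUIMULTIPLICITY of `V(G)`, `G = Φ(x) + Ψ = tᵈ g₁`, along the
section on the chart `i`. Then **the reduction map `θ : A[I/xᵢ] → Ā[Ī/x̄ᵢ]` carries the upstairs strict-transform ideal
`⋃ₙ ((G) : tⁿ)` ONTO the downstairs one `⋃ₙ ((Ḡ) : t̄ⁿ)`**: both are principal (`(g₁)`, `(ḡ₁)`, part 1) and `θ(g₁) = ḡ₁`. So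
the special fibre of the strict transform of `V(G)` along the section is EXACTLY the strict transform of `V(ḡ)` at the point —
no exceptional component (which WOULD appear if `ord_Ī ḡ > m`: then `t̄ ∣ θ(g₁)`). [cite: GortzWedhorn2020, (13.19) p. 414 and Prop. 13.96 (2)]
[OURS · L1 W4.5b] T-M1-EXACT (res-L1-w45b-lead-2 DESIGN v6 (TC⁺) / res-L1-w45b-plan-1 M1 PROXIMITY LIFT) toward the registered stubs
of `EquisingularLiftNat(Three)` (stmt-ResolutionOfSingularities-20038 / -20148); NOT a statement of the manuscript. -/
theorem map_blowupAlgebraMap_strictTransformIdeal_eq (hx : IsQuasiRegular x)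
    [IsDomain (A ⧸ Ideal.span (Set.range x))]
    (hxb : IsQuasiRegular fun l => Ideal.Quotient.mk (Ideal.span {ϖ}) (x l))
    [IsDomain ((A ⧸ Ideal.span {ϖ}) ⧸ Ideal.span (Set.range fun l => Ideal.Quotient.mk (Ideal.span {ϖ}) (x l)))]
    {d : ℕ} {Φ : MvPolynomial (Fin r) A}
    (hΦ : MvPolynomial.map (Ideal.Quotient.mk (Ideal.span (Set.range x))) (dehomogenize i Φ) ≠ 0)
    (hΦb : MvPolynomial.map (Ideal.Quotient.mk (Ideal.span (Set.range fun l => Ideal.Quotient.mk (Ideal.span {ϖ}) (x l))))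
      (dehomogenize i (MvPolynomial.map (Ideal.Quotient.mk (Ideal.span {ϖ})) Φ)) ≠ 0)
    (ψ : blowupAlgebra (Ideal.span (Set.range x)) (x i)) {G : A}
    (hG : algebraMap A (blowupAlgebra (Ideal.span (Set.range x)) (x i)) G =
      algebraMap A (blowupAlgebra (Ideal.span (Set.range x)) (x i)) (x i) ^ d *
        (MvPolynomial.aeval (blowupAlgebra.frac x i) Φ +
          algebraMap A (blowupAlgebra (Ideal.span (Set.range x)) (x i)) (x i) * ψ)) :
    (⨆ n : ℕ, Submodule.colon
        (Ideal.span {algebraMap A (blowupAlgebra (Ideal.span (Set.range x)) (x i)) G})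
        ((Ideal.span {algebraMap A (blowupAlgebra (Ideal.span (Set.range x)) (x i)) (x i)} ^ n :
          Ideal (blowupAlgebra (Ideal.span (Set.range x)) (x i))) : Set _)).map
      (blowupAlgebraMap (Ideal.Quotient.mk (Ideal.span {ϖ})) (Ideal.span (Set.range x))
        (Ideal.span (Set.range fun l => Ideal.Quotient.mk (Ideal.span {ϖ}) (x l))) (x i)
        (map_span_range_le_span_range_mk x ϖ)) =
    ⨆ n : ℕ, Submodule.colon
        (Ideal.span {algebraMap (A ⧸ Ideal.span {ϖ})
          (blowupAlgebra (Ideal.span (Set.range fun l => Ideal.Quotient.mk (Ideal.span {ϖ}) (x l)))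
            (Ideal.Quotient.mk (Ideal.span {ϖ}) (x i))) (Ideal.Quotient.mk (Ideal.span {ϖ}) G)})
        ((Ideal.span {algebraMap (A ⧸ Ideal.span {ϖ})
          (blowupAlgebra (Ideal.span (Set.range fun l => Ideal.Quotient.mk (Ideal.span {ϖ}) (x l)))
            (Ideal.Quotient.mk (Ideal.span {ϖ}) (x i))) (Ideal.Quotient.mk (Ideal.span {ϖ}) (x i))} ^ n :
          Ideal (blowupAlgebra (Ideal.span (Set.range fun l => Ideal.Quotient.mk (Ideal.span {ϖ}) (x l)))
            (Ideal.Quotient.mk (Ideal.span {ϖ}) (x i)))) : Set _) := by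
  rw [iSup_colon_span_tangentCone_eq_span_strictTransform x i hx hΦ ψ hG,
    map_blowupAlgebraMap_span_strictTransform,
    iSup_colon_span_tangentCone_eq_span_strictTransform (fun l => Ideal.Quotient.mk (Ideal.span {ϖ}) (x l)) i hxb hΦb _
      (algebraMap_mk_tangentCone_eq x i ϖ Φ ψ hG)]

/-! ## The model square on the chart: `B/(g, ϖ) ≅ B̄/(θ g)` -/

/-- The kernel of `B → B̄ → B̄/(ḡ)` is `(g) + ϖB` whenever `θ(g) = ḡ`, for ANY `g ∈ B = A[I/xᵢ]` (`x` quasi-regular, `A/I` a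
domain, `ϖ ∉ I`: `θ` is surjective with kernel `ϖB`, `ker_blowupAlgebraMap_quotient_uniformizer` of `…NatDoubledConeSaturation`);
with `blowupAlgebraMap_strictTransform` this applies to the strict transform `g₁`, `θ(g₁) = ḡ₁`.
[cite: GortzWedhorn2020, Prop. 13.96 (2) (proof), p. 416] -/
theorem ker_mk_comp_blowupAlgebraMap_eq (hx : IsQuasiRegular x) [IsDomain (A ⧸ Ideal.span (Set.range x))]
    (hϖ : ϖ ∉ Ideal.span (Set.range x)) (g : blowupAlgebra (Ideal.span (Set.range x)) (x i))
    (gb : blowupAlgebra (Ideal.span (Set.range fun l => Ideal.Quotient.mk (Ideal.span {ϖ}) (x l)))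
      (Ideal.Quotient.mk (Ideal.span {ϖ}) (x i)))
    (hgb : blowupAlgebraMap (Ideal.Quotient.mk (Ideal.span {ϖ})) (Ideal.span (Set.range x))
      (Ideal.span (Set.range fun l => Ideal.Quotient.mk (Ideal.span {ϖ}) (x l))) (x i)
      (map_span_range_le_span_range_mk x ϖ) g = gb) :
    RingHom.ker ((Ideal.Quotient.mk (Ideal.span {gb})).comp
        (blowupAlgebraMap (Ideal.Quotient.mk (Ideal.span {ϖ})) (Ideal.span (Set.range x))
          (Ideal.span (Set.range fun l => Ideal.Quotient.mk (Ideal.span {ϖ}) (x l))) (x i)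
          (map_span_range_le_span_range_mk x ϖ))) =
      Ideal.span {g} ⊔ Ideal.span {algebraMap A (blowupAlgebra (Ideal.span (Set.range x)) (x i)) ϖ} := by
  subst hgb
  set θ := blowupAlgebraMap (Ideal.Quotient.mk (Ideal.span {ϖ})) (Ideal.span (Set.range x))
    (Ideal.span (Set.range fun l => Ideal.Quotient.mk (Ideal.span {ϖ}) (x l))) (x i)
    (map_span_range_le_span_range_mk x ϖ) with hθ
  have hθsurj : Function.Surjective θ :=
    blowupAlgebraMap_surjective _ _ _ _ Ideal.Quotient.mk_surjective _ (map_span_range_eq_span_range_mk x ϖ).ge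
  have hker : RingHom.ker θ = Ideal.span {algebraMap A (blowupAlgebra (Ideal.span (Set.range x)) (x i)) ϖ} := by
    rw [hθ, ker_blowupAlgebraMap_quotient_uniformizer x i hx hϖ, Ideal.map_span, Set.image_singleton]
  have hmap : (Ideal.span {g}).map θ = Ideal.span {θ g} := by rw [Ideal.map_span, Set.image_singleton]
  rw [← RingHom.comap_ker, Ideal.mk_ker, ← hmap, Ideal.comap_map_of_surjective _ hθsurj, ← RingHom.ker_eq_comap_bot, hker]

/-- **The MODEL SQUARE on the chart: `A[I/xᵢ]/(g, ϖ) ≅ Ā[Ī/x̄ᵢ]/(ḡ)`** for any `g` with reduction `θ(g) = ḡ` (`x` quasi-regular,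
`A/I` a domain, `ϖ ∉ I`), compatibly with `θ`. For the strict transform `g = g₁`, `θ(g₁) = ḡ₁` (`blowupAlgebraMap_strictTransform`):
reducing the strict-transform chart `B/(g₁)` (= `(A/(G))[Ī/x̄ᵢ]`, part 1) modulo the uniformizer gives the downstairs
strict-transform chart `B̄/(ḡ₁)` (= `(Ā/(Ḡ))[…]`, part 1 downstairs, under equimultiplicity) — the chart form of the hypothesis
`C.comap j = D` of `modelStep` (…NatModelStep) for the proximity-lift centre. [cite: GortzWedhorn2020, Prop. 13.96 (2)]
[OURS · L1 W4.5b] T-M1-EXACT; NOT a statement of the manuscript. -/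
theorem exists_quotient_sup_uniformizer_equiv (hx : IsQuasiRegular x) [IsDomain (A ⧸ Ideal.span (Set.range x))]
    (hϖ : ϖ ∉ Ideal.span (Set.range x)) (g : blowupAlgebra (Ideal.span (Set.range x)) (x i))
    (gb : blowupAlgebra (Ideal.span (Set.range fun l => Ideal.Quotient.mk (Ideal.span {ϖ}) (x l)))
      (Ideal.Quotient.mk (Ideal.span {ϖ}) (x i)))
    (hgb : blowupAlgebraMap (Ideal.Quotient.mk (Ideal.span {ϖ})) (Ideal.span (Set.range x))
      (Ideal.span (Set.range fun l => Ideal.Quotient.mk (Ideal.span {ϖ}) (x l))) (x i)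
      (map_span_range_le_span_range_mk x ϖ) g = gb) :
    ∃ ε : (blowupAlgebra (Ideal.span (Set.range x)) (x i) ⧸
        (Ideal.span {g} ⊔ Ideal.span {algebraMap A (blowupAlgebra (Ideal.span (Set.range x)) (x i)) ϖ})) ≃+*
        (blowupAlgebra (Ideal.span (Set.range fun l => Ideal.Quotient.mk (Ideal.span {ϖ}) (x l)))
            (Ideal.Quotient.mk (Ideal.span {ϖ}) (x i)) ⧸ Ideal.span {gb}),
      ∀ b, ε (Ideal.Quotient.mk _ b) = Ideal.Quotient.mk _
        (blowupAlgebraMap (Ideal.Quotient.mk (Ideal.span {ϖ})) (Ideal.span (Set.range x))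
          (Ideal.span (Set.range fun l => Ideal.Quotient.mk (Ideal.span {ϖ}) (x l))) (x i)
          (map_span_range_le_span_range_mk x ϖ) b) := by
  have hθsurj : Function.Surjective (blowupAlgebraMap (Ideal.Quotient.mk (Ideal.span {ϖ})) (Ideal.span (Set.range x))
      (Ideal.span (Set.range fun l => Ideal.Quotient.mk (Ideal.span {ϖ}) (x l))) (x i)
      (map_span_range_le_span_range_mk x ϖ)) :=
    blowupAlgebraMap_surjective _ _ _ _ Ideal.Quotient.mk_surjective _ (map_span_range_eq_span_range_mk x ϖ).ge
  have hker := ker_mk_comp_blowupAlgebraMap_eq x i ϖ hx hϖ g gb hgb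
  have hsurj : Function.Surjective ((Ideal.Quotient.mk (Ideal.span {gb})).comp
      (blowupAlgebraMap (Ideal.Quotient.mk (Ideal.span {ϖ})) (Ideal.span (Set.range x))
        (Ideal.span (Set.range fun l => Ideal.Quotient.mk (Ideal.span {ϖ}) (x l))) (x i)
        (map_span_range_le_span_range_mk x ϖ))) :=
    Ideal.Quotient.mk_surjective.comp hθsurj
  -- the compatibility holds by `rfl` (a `rw` chain through `RingEquiv.trans_apply` is prohibitively slow on these types)
  exact ⟨(Ideal.quotEquivOfEq hker.symm).trans (RingHom.quotientKerEquivOfSurjective hsurj), fun b => rfl⟩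

/-! ## Order one transfers from the special fibre up -/

/-- **Order one transfers UP along the reduction.** At a prime `𝔐̄` of `Ā[Ī/x̄ᵢ]`, with `𝔐 = θ⁻¹(𝔐̄)`: if the reduction `θ(g)` of
`g ∈ A[I/xᵢ]` has order one in `Ā[Ī/x̄ᵢ]_𝔐̄` (`θ g ∉ 𝔪̄²`), then `g ∉ 𝔪²` in `A[I/xᵢ]_𝔐` (the induced map of local rings is
local). [folklore] -/
theorem notMem_sq_of_blowupAlgebraMap_notMem_sq
    (𝔐b : Ideal (blowupAlgebra (Ideal.span (Set.range fun l => Ideal.Quotient.mk (Ideal.span {ϖ}) (x l)))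
      (Ideal.Quotient.mk (Ideal.span {ϖ}) (x i)))) [𝔐b.IsPrime]
    (g : blowupAlgebra (Ideal.span (Set.range x)) (x i))
    (hg : algebraMap _ (Localization.AtPrime 𝔐b)
        (blowupAlgebraMap (Ideal.Quotient.mk (Ideal.span {ϖ})) (Ideal.span (Set.range x))
          (Ideal.span (Set.range fun l => Ideal.Quotient.mk (Ideal.span {ϖ}) (x l))) (x i)
          (map_span_range_le_span_range_mk x ϖ) g) ∉
      maximalIdeal (Localization.AtPrime 𝔐b) ^ 2) :
    algebraMap (blowupAlgebra (Ideal.span (Set.range x)) (x i))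
        (Localization.AtPrime (𝔐b.comap (blowupAlgebraMap (Ideal.Quotient.mk (Ideal.span {ϖ})) (Ideal.span (Set.range x))
          (Ideal.span (Set.range fun l => Ideal.Quotient.mk (Ideal.span {ϖ}) (x l))) (x i)
          (map_span_range_le_span_range_mk x ϖ)))) g ∉
      maximalIdeal (Localization.AtPrime (𝔐b.comap (blowupAlgebraMap (Ideal.Quotient.mk (Ideal.span {ϖ}))
        (Ideal.span (Set.range x)) (Ideal.span (Set.range fun l => Ideal.Quotient.mk (Ideal.span {ϖ}) (x l))) (x i)
        (map_span_range_le_span_range_mk x ϖ)))) ^ 2 := by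
  set θ := blowupAlgebraMap (Ideal.Quotient.mk (Ideal.span {ϖ})) (Ideal.span (Set.range x))
    (Ideal.span (Set.range fun l => Ideal.Quotient.mk (Ideal.span {ϖ}) (x l))) (x i)
    (map_span_range_le_span_range_mk x ϖ) with hθ
  intro hmem
  apply hg
  have hφ : Localization.localRingHom (𝔐b.comap θ) 𝔐b θ rfl (algebraMap _ (Localization.AtPrime (𝔐b.comap θ)) g) =
      algebraMap _ (Localization.AtPrime 𝔐b) (θ g) :=
    Localization.localRingHom_to_map (𝔐b.comap θ) 𝔐b θ rfl g
  rw [← hφ]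
  have hmax : (maximalIdeal (Localization.AtPrime (𝔐b.comap θ))).map (Localization.localRingHom (𝔐b.comap θ) 𝔐b θ rfl) ≤
      maximalIdeal (Localization.AtPrime 𝔐b) :=
    Ideal.map_le_iff_le_comap.mpr fun a ha => map_nonunit (Localization.localRingHom (𝔐b.comap θ) 𝔐b θ rfl) a ha
  have hle : (maximalIdeal (Localization.AtPrime (𝔐b.comap θ)) ^ 2).map
      (Localization.localRingHom (𝔐b.comap θ) 𝔐b θ rfl) ≤ maximalIdeal (Localization.AtPrime 𝔐b) ^ 2 := by
    rw [Ideal.map_pow]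
    exact Ideal.pow_right_mono hmax 2
  exact hle (Ideal.mem_map_of_mem _ hmem)

/-- **The proximity-lift centre is regular wherever the downstairs strict transform has order one.** `A`, `A/I` regular rings,
`x` quasi-regular (so `A[I/xᵢ]` is regular); `g ∈ A[I/xᵢ]` (e.g. the strict transform `g₁ = Φ(e) + tψ` of `G = Φ(x) + Ψ` along the
section, `θ(g₁) = ḡ₁` by `blowupAlgebraMap_strictTransform`); at a prime `𝔐̄` of `Ā[Ī/x̄ᵢ]` containing `θ(g)` at which
`θ(g) ∉ 𝔪̄²` (e.g. a point where the downstairs strict transform `St_q V(ḡ)` is a regular hypersurface of the regular chart), the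
local ring of `V(g)` at `𝔐 = θ⁻¹𝔐̄` — in any model `S` of `A[I/xᵢ]_𝔐` — is a REGULAR local ring of dimension `dim A[I/xᵢ]_𝔐 - 1`.
[cite: Matsumura1987, Thm. 14.2] [cite: Liu2002, Thm. 8.1.19 (a)] [OURS · L1 W4.5b] T-M1-EXACT toward
`stub_elnat_three_isolated_nontc` / `stub_elnat_tcDeltaPointResolution`; NOT a statement of the manuscript. -/
theorem isRegularLocalRing_quotient_of_reduction_notMem_sq [IsRegularRing A] (hx : IsQuasiRegular x)
    [IsRegularRing (A ⧸ Ideal.span (Set.range x))] (g : blowupAlgebra (Ideal.span (Set.range x)) (x i))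
    (𝔐b : Ideal (blowupAlgebra (Ideal.span (Set.range fun l => Ideal.Quotient.mk (Ideal.span {ϖ}) (x l)))
      (Ideal.Quotient.mk (Ideal.span {ϖ}) (x i)))) [𝔐b.IsPrime]
    (hgb : blowupAlgebraMap (Ideal.Quotient.mk (Ideal.span {ϖ})) (Ideal.span (Set.range x))
        (Ideal.span (Set.range fun l => Ideal.Quotient.mk (Ideal.span {ϖ}) (x l))) (x i)
        (map_span_range_le_span_range_mk x ϖ) g ∈ 𝔐b)
    (hsq : algebraMap _ (Localization.AtPrime 𝔐b)
        (blowupAlgebraMap (Ideal.Quotient.mk (Ideal.span {ϖ})) (Ideal.span (Set.range x))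
          (Ideal.span (Set.range fun l => Ideal.Quotient.mk (Ideal.span {ϖ}) (x l))) (x i)
          (map_span_range_le_span_range_mk x ϖ) g) ∉
      maximalIdeal (Localization.AtPrime 𝔐b) ^ 2)
    (S : Type u) [CommRing S] [Algebra (blowupAlgebra (Ideal.span (Set.range x)) (x i)) S]
    [IsLocalization.AtPrime S (𝔐b.comap (blowupAlgebraMap (Ideal.Quotient.mk (Ideal.span {ϖ}))
      (Ideal.span (Set.range x)) (Ideal.span (Set.range fun l => Ideal.Quotient.mk (Ideal.span {ϖ}) (x l))) (x i)
      (map_span_range_le_span_range_mk x ϖ)))] :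
    IsRegularLocalRing (S ⧸ Ideal.span {algebraMap (blowupAlgebra (Ideal.span (Set.range x)) (x i)) S g}) ∧
      ringKrullDim (S ⧸ Ideal.span {algebraMap (blowupAlgebra (Ideal.span (Set.range x)) (x i)) S g}) + 1 =
        ringKrullDim S := by
  haveI : IsRegularRing (blowupAlgebra (Ideal.span (Set.range x)) (x i)) := blowupAlgebra.isRegularRing x i hx
  haveI : (𝔐b.comap (blowupAlgebraMap (Ideal.Quotient.mk (Ideal.span {ϖ}))
      (Ideal.span (Set.range x)) (Ideal.span (Set.range fun l => Ideal.Quotient.mk (Ideal.span {ϖ}) (x l))) (x i)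
      (map_span_range_le_span_range_mk x ϖ))).IsPrime := Ideal.IsPrime.comap _
  refine isRegularLocalRing_quotient_span_algebraMap_of_notMem_sq
    (𝔐b.comap (blowupAlgebraMap (Ideal.Quotient.mk (Ideal.span {ϖ}))
      (Ideal.span (Set.range x)) (Ideal.span (Set.range fun l => Ideal.Quotient.mk (Ideal.span {ϖ}) (x l))) (x i)
      (map_span_range_le_span_range_mk x ϖ))) ?_ ?_ S
  · rw [Ideal.mem_comap]
    exact hgb
  · exact notMem_sq_of_blowupAlgebraMap_notMem_sq x i ϖ 𝔐b g hsq

end Reduction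

/-! ## Part 1's saturation in stalk currency -/

section Localization

variable {A : Type u} [CommRing A] {r : ℕ} (x : Fin r → A) (i : Fin r)

/-- **The strict-transform ideal is `(g₁)` in every localisation of the chart** (the local rings of the blow-up at the points of
`D₊(xᵢ)`): `⋃ₙ ((G) : tⁿ) = (g₁)` in `S` for `S` a localisation of `A[I/xᵢ]`, under the hypotheses of part 1
(`x` quasi-regular, `A/I` a domain, `Φᵢ mod I ≠ 0`, `G = tᵈ g₁`, `g₁ = Φ(e) + tψ`). [cite: GortzWedhorn2020, (13.19) p. 414] -/
theorem iSup_colon_span_tangentCone_eq_span_strictTransform_localization (hx : IsQuasiRegular x)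
    [IsDomain (A ⧸ Ideal.span (Set.range x))] {d : ℕ} {Φ : MvPolynomial (Fin r) A}
    (hΦ : MvPolynomial.map (Ideal.Quotient.mk (Ideal.span (Set.range x))) (dehomogenize i Φ) ≠ 0)
    (ψ : blowupAlgebra (Ideal.span (Set.range x)) (x i)) {G : A}
    (hG : algebraMap A (blowupAlgebra (Ideal.span (Set.range x)) (x i)) G =
      algebraMap A (blowupAlgebra (Ideal.span (Set.range x)) (x i)) (x i) ^ d *
        (MvPolynomial.aeval (blowupAlgebra.frac x i) Φ +
          algebraMap A (blowupAlgebra (Ideal.span (Set.range x)) (x i)) (x i) * ψ))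
    (M : Submonoid (blowupAlgebra (Ideal.span (Set.range x)) (x i))) (S : Type*) [CommRing S]
    [Algebra (blowupAlgebra (Ideal.span (Set.range x)) (x i)) S] [IsLocalization M S] :
    ⨆ n : ℕ, Submodule.colon
        (Ideal.span {algebraMap (blowupAlgebra (Ideal.span (Set.range x)) (x i)) S
          (algebraMap A (blowupAlgebra (Ideal.span (Set.range x)) (x i)) G)})
        ((Ideal.span {algebraMap (blowupAlgebra (Ideal.span (Set.range x)) (x i)) S
          (algebraMap A (blowupAlgebra (Ideal.span (Set.range x)) (x i)) (x i))} ^ n : Ideal S) : Set S) =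
      Ideal.span {algebraMap (blowupAlgebra (Ideal.span (Set.range x)) (x i)) S
        (MvPolynomial.aeval (blowupAlgebra.frac x i) Φ +
          algebraMap A (blowupAlgebra (Ideal.span (Set.range x)) (x i)) (x i) * ψ)} := by
  -- adapted from `iSup_colon_span_eval_eq_span_coneTransform_localization` (…NatConeChart, the pure cone)
  rw [hG, map_mul, map_pow]
  exact iSup_colon_span_pow_mul_eq (S := S)
    (t := algebraMap _ S (algebraMap A (blowupAlgebra (Ideal.span (Set.range x)) (x i)) (x i)))
    (c := algebraMap _ S (MvPolynomial.aeval (blowupAlgebra.frac x i) Φ +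
      algebraMap A (blowupAlgebra (Ideal.span (Set.range x)) (x i)) (x i) * ψ))
    (IsLocalization.nonZeroDivisors_le_comap M S
      (algebraMap_mem_nonZeroDivisors_blowupAlgebra (I := Ideal.span (Set.range x)) (a := x i)))
    (mem_span_algebraMap_of_mul_mem_localization M S
      (fun y hy => mem_span_strictTransform_of_algebraMap_mul_mem x i hx hΦ ψ y hy)) d

end Localization

end Summit.ResolutionOfSingularities.ResolutionOfSingularities.Cruxes.EquisingularLiftNat.Sections

end
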